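import Mathlib
import Summits.MatrixMultiplication.Statement
import Summits.MatrixMultiplication.MatrixMultiplication.Theorems.GraphEquationsAffineQuadric

/-!
# GraphEquations — torus weights on `ℂ[A,B,C]` and sorted monomials (M42a; cell `decomp-mm`, lens-5 g40)

Helper kernel beneath the attacked crux `MultiplicityReduction` (stmt-MatrixMultiplication-27806) of
route `GraphEquations`, rung `K = 3` of the degree ladder; first third of the CUBIC NORMAL FORM `NFₙ`
(`GraphEquationsCubicNormalForm.exists_affTest_of_cubic`).  Sorry-free content:

* points `pt A B C` of `ℂ^{3n²}` and `(A,B,C) ∈ W_n ↔ C = AB` (`pt_mem_mmGraph_iff`);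
* the torus weight `wt : a ↦ (1,0), b ↦ (0,1), c ↦ (1,1)` and the action `scalePt s r : (A,B,C) ↦ (sA,rB,srC)`,
  which preserves the graph (`scalePt_mem`) and scales a weighted homogeneous polynomial of weight `m` by
  `s^{m₁} r^{m₂}` (`eval_scalePt_of_isWeightedHomogeneous`);
* a two-variable Vandermonde lemma (`eq_zero_of_forall_sum_mul_pow_eq_zero`) and its consequence:
  **every weighted homogeneous component of a polynomial vanishing on `W_n` vanishes on `W_n`**
  (`eval_component_eq_zero`);
* monomials through the multiset of their variables, sorted into the three blocks (`sorted sa sb sc`):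
  degree `|sa|+|sb|+|sc|`, weight `(|sa|+|sc|, |sb|+|sc|)` (`weight_sorted`) and value
  `c · Π A(sa) · Π B(sb) · Π C(sc)` (`eval_pt_monomial_sorted`).
-/

set_option linter.dupNamespace false
set_option linter.unusedSectionVars false

noncomputable section

namespace Summit.MatrixMultiplication.MatrixMultiplication.Theorems.GraphEquations

open MvPolynomial Matrix

variable {n : ℕ}

/-! ## Points `(A, B, C)` of `ℂ^{3n²}` -/

/-- The point `(A, B, C)`. -/
def pt (A B C : Vec n) : GraphVars n → ℂ := Sum.elim (Sum.elim A B) C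

/-- `a`-coordinates of `(A,B,C)`. -/
@[simp] theorem pt_a (A B C : Vec n) (v : Fin n × Fin n) : pt A B C (Sum.inl (Sum.inl v)) = A v := rfl
/-- `b`-coordinates of `(A,B,C)`. -/
@[simp] theorem pt_b (A B C : Vec n) (t : Fin n × Fin n) : pt A B C (Sum.inl (Sum.inr t)) = B t := rfl
/-- `c`-coordinates of `(A,B,C)`. -/
@[simp] theorem pt_c (A B C : Vec n) (q : Fin n × Fin n) : pt A B C (Sum.inr q) = C q := rfl

/-- Every point is `(A, B, C)` for its three coordinate blocks. -/
theorem pt_eta (x : GraphVars n → ℂ) :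
    pt (fun v => x (Sum.inl (Sum.inl v))) (fun t => x (Sum.inl (Sum.inr t))) (fun q => x (Sum.inr q))
      = x := by
  funext i; rcases i with (v | t) | q <;> rfl

/-- `(A, B, C) ∈ W_n ↔ C = AB`. -/
theorem pt_mem_mmGraph_iff (A B C : Vec n) : pt A B C ∈ mmGraph n ↔ C = prodVec A B := by
  constructor
  · intro h; funext q; obtain ⟨i, l⟩ := q
    simpa [pt, prodVec, prodEntry, mmGraph] using h i l
  · rintro rfl i l; simp [pt, prodVec, prodEntry]

/-- `(A, B, AB) ∈ W_n`. -/
theorem pt_prodVec_mem (A B : Vec n) : pt A B (prodVec A B) ∈ mmGraph n :=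
  (pt_mem_mmGraph_iff A B _).2 rfl

/-! ## The torus weight and the vanishing of weighted homogeneous components -/

/-- The torus weight: `a ↦ (1,0)`, `b ↦ (0,1)`, `c ↦ (1,1)`. -/
def wt : GraphVars n → ℕ × ℕ
  | Sum.inl (Sum.inl _) => (1, 0)
  | Sum.inl (Sum.inr _) => (0, 1)
  | Sum.inr _ => (1, 1)

/-- weight of an `a`-variable -/
@[simp] theorem wt_a (v : Fin n × Fin n) : wt (n := n) (Sum.inl (Sum.inl v)) = (1, 0) := rfl
/-- weight of a `b`-variable -/
@[simp] theorem wt_b (t : Fin n × Fin n) : wt (n := n) (Sum.inl (Sum.inr t)) = (0, 1) := rfl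
/-- weight of a `c`-variable -/
@[simp] theorem wt_c (q : Fin n × Fin n) : wt (n := n) (Sum.inr q) = (1, 1) := rfl

/-- The torus action `(A,B,C) ↦ (sA, rB, srC)` on coordinates. -/
def scalePt (s r : ℂ) (x : GraphVars n → ℂ) : GraphVars n → ℂ :=
  fun i => s ^ (wt i).1 * r ^ (wt i).2 * x i

/-- The graph is stable under the torus. -/
theorem scalePt_mem {x : GraphVars n → ℂ} (hx : x ∈ mmGraph n) (s r : ℂ) :
    scalePt s r x ∈ mmGraph n := by
  intro i l
  simp only [scalePt, wt_a, wt_b, wt_c, pow_one, pow_zero, one_mul, mul_one]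
  rw [hx i l, Finset.mul_sum]
  exact Finset.sum_congr rfl fun j _ => by ring

/-- A weighted homogeneous polynomial of weight `m` scales by `s^{m₁} r^{m₂}` under the torus. -/
theorem eval_scalePt_of_isWeightedHomogeneous {p : MvPolynomial (GraphVars n) ℂ} {m : ℕ × ℕ}
    (hp : IsWeightedHomogeneous wt p m) (s r : ℂ) (x : GraphVars n → ℂ) :
    eval (scalePt s r x) p = s ^ m.1 * r ^ m.2 * eval x p := by
  classical
  conv_lhs => rw [p.as_sum]
  conv_rhs => rw [p.as_sum]
  rw [map_sum, map_sum, Finset.mul_sum]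
  refine Finset.sum_congr rfl fun d hd => ?_
  have hw : Finsupp.weight wt d = m := hp (mem_support_iff.1 hd)
  rw [eval_monomial, eval_monomial]
  have h1 : (d.prod fun i k => scalePt s r x i ^ k)
      = (d.prod fun i k => s ^ ((wt i).1 * k)) * (d.prod fun i k => r ^ ((wt i).2 * k))
        * d.prod fun i k => x i ^ k := by
    unfold Finsupp.prod
    rw [← Finset.prod_mul_distrib, ← Finset.prod_mul_distrib]
    exact Finset.prod_congr rfl fun i _ => by simp only [scalePt, mul_pow, pow_mul]
  have h2 : ∀ (f : GraphVars n → ℕ) (z : ℂ), (d.prod fun i k => z ^ (f i * k))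
      = z ^ (d.sum fun i k => k • f i) := by
    intro f z
    unfold Finsupp.prod Finsupp.sum
    rw [Finset.prod_pow_eq_pow_sum]
    exact congrArg _ (Finset.sum_congr rfl fun i _ => by simp only [smul_eq_mul]; ring)
  have hw1 : (d.sum fun i k => k • (wt i).1) = m.1 := by
    rw [← hw, Finsupp.weight_apply]; unfold Finsupp.sum
    rw [Prod.fst_sum]; rfl
  have hw2 : (d.sum fun i k => k • (wt i).2) = m.2 := by
    rw [← hw, Finsupp.weight_apply]; unfold Finsupp.sum
    rw [Prod.snd_sum]; rfl
  rw [h1, h2 (fun i => (wt i).1) s, h2 (fun i => (wt i).2) r, hw1, hw2]; ring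

/-- Two-variable Vandermonde: if `Σ_{m ∈ S} c_m s^{m₁} r^{m₂} = 0` for all `s, r ∈ ℂ` then all `c_m = 0`. -/
theorem eq_zero_of_forall_sum_mul_pow_eq_zero (S : Finset (ℕ × ℕ)) (c : ℕ × ℕ → ℂ)
    (h : ∀ s r : ℂ, ∑ m ∈ S, c m * (s ^ m.1 * r ^ m.2) = 0) : ∀ m ∈ S, c m = 0 := by
  classical
  let e : ℕ × ℕ → (Fin 2 →₀ ℕ) := fun m => Finsupp.single 0 m.1 + Finsupp.single 1 m.2
  have he : ∀ m m' : ℕ × ℕ, e m = e m' → m = m' := by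
    intro m m' hmm'
    have h0 := DFunLike.congr_fun hmm' 0
    have h1 := DFunLike.congr_fun hmm' 1
    simp only [e, Finsupp.coe_add, Pi.add_apply, Finsupp.single_eq_same,
      Finsupp.single_eq_of_ne (show (0 : Fin 2) ≠ 1 by decide),
      Finsupp.single_eq_of_ne (show (1 : Fin 2) ≠ 0 by decide), add_zero, zero_add] at h0 h1
    exact Prod.ext h0 h1
  let Q : MvPolynomial (Fin 2) ℂ := ∑ m ∈ S, monomial (e m) (c m)
  have hQ : Q = 0 := by
    apply MvPolynomial.funext
    intro x
    rw [map_zero]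
    have hx := h (x 0) (x 1)
    simp only [Q, map_sum, eval_monomial]
    rw [← hx]
    refine Finset.sum_congr rfl fun m _ => ?_
    congr 1
    rw [Finsupp.prod_add_index', Finsupp.prod_single_index, Finsupp.prod_single_index]
    · simp
    · simp
    · intro a; simp
    · intro a b₁ b₂; rw [pow_add]
  intro m hm
  have hc : coeff (e m) Q = c m := by
    simp only [Q, coeff_sum, coeff_monomial]
    rw [Finset.sum_eq_single m]
    · simp
    · intro m' _ hm'; rw [if_neg]; exact fun h' => hm' (he _ _ h')
    · intro hm'; exact absurd hm hm'
  rw [← hc, hQ, coeff_zero]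

/-- The decomposition of `t` into its weighted homogeneous components, as a finite sum. -/
theorem sum_weightedHomogeneousComponent_eq (t : MvPolynomial (GraphVars n) ℂ)
    (S : Finset (ℕ × ℕ)) (hS : Finset.image (Finsupp.weight wt) t.support ⊆ S) :
    ∑ m ∈ S, weightedHomogeneousComponent wt m t = t := by
  classical
  have hsupp : Function.support (fun m => weightedHomogeneousComponent wt m t) ⊆ (S : Set (ℕ × ℕ)) := by
    intro m hm
    rw [Function.mem_support] at hm
    by_contra hmS
    apply hm
    apply weightedHomogeneousComponent_eq_zero'
    intro d hd hdm
    exact hmS (hS (Finset.mem_image.2 ⟨d, hd, hdm⟩))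
  calc ∑ m ∈ S, weightedHomogeneousComponent wt m t
      = ∑ᶠ m, weightedHomogeneousComponent wt m t := (finsum_eq_sum_of_support_subset _ hsupp).symm
    _ = t := sum_weightedHomogeneousComponent wt t

/-- **Each weighted homogeneous component of a polynomial vanishing on `W_n` vanishes on `W_n`.** -/
theorem eval_component_eq_zero {t : MvPolynomial (GraphVars n) ℂ}
    (hv : ∀ x ∈ mmGraph n, eval x t = 0) (m : ℕ × ℕ) {x : GraphVars n → ℂ} (hx : x ∈ mmGraph n) :
    eval x (weightedHomogeneousComponent wt m t) = 0 := by
  classical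
  let S := Finset.image (Finsupp.weight wt) t.support
  have hmain : ∀ m ∈ S, eval x (weightedHomogeneousComponent wt m t) = 0 := by
    refine eq_zero_of_forall_sum_mul_pow_eq_zero S
      (fun m => eval x (weightedHomogeneousComponent wt m t)) fun s r => ?_
    have h0 := hv _ (scalePt_mem hx s r)
    rw [← sum_weightedHomogeneousComponent_eq t S (Finset.Subset.refl _), map_sum] at h0
    rw [← h0]
    refine Finset.sum_congr rfl fun m _ => ?_
    rw [eval_scalePt_of_isWeightedHomogeneous (weightedHomogeneousComponent_isWeightedHomogeneous m t)]
    ring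
  by_cases hm : m ∈ S
  · exact hmain m hm
  · rw [weightedHomogeneousComponent_eq_zero', map_zero]
    intro d hd hdm
    exact hm (Finset.mem_image.2 ⟨d, hd, hdm⟩)

/-! ## Monomials through the sorted multiset of their variables -/

section Multiset

variable {σ : Type*} [DecidableEq σ] {R : Type*} [CommSemiring R]

/-- `monomial (toFinsupp s) c = c · Π_{i ∈ s} X_i`. -/
theorem monomial_toFinsupp (s : Multiset σ) (c : R) :
    monomial (Multiset.toFinsupp s) c = C c * (s.map X).prod := by
  induction s using Multiset.induction_on with
  | empty => simp
  | cons a s ih =>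
    rw [← Multiset.singleton_add, Multiset.toFinsupp_add, Multiset.toFinsupp_singleton,
      monomial_single_add, ih, Multiset.map_add, Multiset.prod_add, Multiset.map_singleton,
      Multiset.prod_singleton, pow_one]
    ring

/-- `eval x (c · Π_{i ∈ s} X_i) = c · Π_{i ∈ s} x_i`. -/
theorem eval_C_mul_prod_map_X (s : Multiset σ) (c : R) (x : σ → R) :
    eval x (C c * (s.map X).prod) = c * (s.map x).prod := by
  rw [map_mul, eval_C, map_multiset_prod, Multiset.map_map]
  congr 2
  exact Multiset.map_congr rfl fun i _ => by simp

/-- Evaluation of a monomial through its multiset of variables. -/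
theorem eval_monomial_toFinsupp (s : Multiset σ) (c : R) (x : σ → R) :
    eval x (monomial (Multiset.toFinsupp s) c) = c * (s.map x).prod := by
  rw [monomial_toFinsupp, eval_C_mul_prod_map_X]

/-- Weight of a monomial through its multiset of variables. -/
theorem weight_toFinsupp {M : Type*} [AddCommMonoid M] (w : σ → M) (s : Multiset σ) :
    Finsupp.weight w (Multiset.toFinsupp s) = (s.map w).sum := by
  induction s using Multiset.induction_on with
  | empty => simp [Multiset.toFinsupp_zero]
  | cons a s ih =>
    rw [← Multiset.singleton_add, Multiset.toFinsupp_add, map_add, Multiset.toFinsupp_singleton,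
      Finsupp.weight_single, one_smul, ih, Multiset.map_add, Multiset.sum_add, Multiset.map_singleton,
      Multiset.sum_singleton]

/-- Degree of a monomial through its multiset of variables. -/
theorem degree_toFinsupp (s : Multiset σ) :
    ((Multiset.toFinsupp s).sum fun _ e => e) = Multiset.card s :=
  Multiset.toFinsupp_sum_eq s

end Multiset

/-- The `a`-, `b`-, `c`-variables. -/
def aVar (v : Fin n × Fin n) : GraphVars n := Sum.inl (Sum.inl v)
/-- see `aVar` -/
def bVar (t : Fin n × Fin n) : GraphVars n := Sum.inl (Sum.inr t)
/-- see `aVar` -/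
def cVar (q : Fin n × Fin n) : GraphVars n := Sum.inr q

/-- The sorted multiset `a`-part ⊎ `b`-part ⊎ `c`-part. -/
def sorted (sa sb sc : Multiset (Fin n × Fin n)) : Multiset (GraphVars n) :=
  sa.map aVar + sb.map bVar + sc.map cVar

/-- Every multiset of variables sorts into its three blocks. -/
theorem exists_sort (s : Multiset (GraphVars n)) :
    ∃ sa sb sc : Multiset (Fin n × Fin n), s = sorted sa sb sc := by
  induction s using Multiset.induction_on with
  | empty => exact ⟨0, 0, 0, by simp [sorted]⟩
  | cons i s ih =>
    obtain ⟨sa, sb, sc, rfl⟩ := ih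
    rcases i with (v | t) | q
    · exact ⟨v ::ₘ sa, sb, sc, by simp [sorted, aVar, Multiset.cons_add]⟩
    · exact ⟨sa, t ::ₘ sb, sc, by simp [sorted, bVar, Multiset.add_cons, Multiset.cons_add]⟩
    · exact ⟨sa, sb, q ::ₘ sc, by simp [sorted, cVar, Multiset.add_cons]⟩

/-- Every exponent vector is the sorted multiset of its variables. -/
theorem exists_sorted (d : GraphVars n →₀ ℕ) :
    ∃ sa sb sc : Multiset (Fin n × Fin n), d = Multiset.toFinsupp (sorted sa sb sc) := by
  classical
  obtain ⟨sa, sb, sc, h⟩ := exists_sort (Finsupp.toMultiset d)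
  exact ⟨sa, sb, sc, by rw [← h, Finsupp.toMultiset_toFinsupp]⟩

/-- Degree of a sorted monomial. -/
theorem card_sorted (sa sb sc : Multiset (Fin n × Fin n)) :
    Multiset.card (sorted sa sb sc) = Multiset.card sa + Multiset.card sb + Multiset.card sc := by
  simp [sorted]

/-- Weight of a sorted monomial: `(|a| + |c|, |b| + |c|)`. -/
theorem weight_sorted (sa sb sc : Multiset (Fin n × Fin n)) :
    Finsupp.weight wt (Multiset.toFinsupp (sorted sa sb sc))
      = (Multiset.card sa + Multiset.card sc, Multiset.card sb + Multiset.card sc) := by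
  classical
  rw [weight_toFinsupp, sorted, Multiset.map_add, Multiset.map_add, Multiset.sum_add, Multiset.sum_add,
    Multiset.map_map, Multiset.map_map, Multiset.map_map]
  have ha : (Multiset.map (wt ∘ aVar) sa).sum = (Multiset.card sa, 0) := by
    rw [show (wt ∘ aVar : Fin n × Fin n → ℕ × ℕ) = fun _ => (1, 0) from rfl, Multiset.map_const',
      Multiset.sum_replicate]; ext <;> simp
  have hb : (Multiset.map (wt ∘ bVar) sb).sum = (0, Multiset.card sb) := by
    rw [show (wt ∘ bVar : Fin n × Fin n → ℕ × ℕ) = fun _ => (0, 1) from rfl, Multiset.map_const',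
      Multiset.sum_replicate]; ext <;> simp
  have hc : (Multiset.map (wt ∘ cVar) sc).sum = (Multiset.card sc, Multiset.card sc) := by
    rw [show (wt ∘ cVar : Fin n × Fin n → ℕ × ℕ) = fun _ => (1, 1) from rfl, Multiset.map_const',
      Multiset.sum_replicate]; ext <;> simp
  rw [ha, hb, hc]; ext <;> simp

/-- Value of a sorted monomial at `(A, B, C)`. -/
theorem eval_pt_monomial_sorted (sa sb sc : Multiset (Fin n × Fin n)) (c : ℂ) (A B C : Vec n) :
    eval (pt A B C) (monomial (Multiset.toFinsupp (sorted sa sb sc)) c)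
      = c * (sa.map A).prod * (sb.map B).prod * (sc.map C).prod := by
  classical
  rw [eval_monomial_toFinsupp, sorted, Multiset.map_add, Multiset.map_add, Multiset.prod_add,
    Multiset.prod_add, Multiset.map_map, Multiset.map_map, Multiset.map_map]
  have ha : (pt A B C ∘ aVar) = A := funext fun v => rfl
  have hb : (pt A B C ∘ bVar) = B := funext fun v => rfl
  have hc : (pt A B C ∘ cVar) = C := funext fun v => rfl
  rw [ha, hb, hc]; ring

/-- `Π` over the empty multiset. -/
@[simp] theorem prod_map_zero' {X : Type*} (f : X → ℂ) : (Multiset.map f 0).prod = 1 := by simp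
/-- `Π` over a singleton. -/
@[simp] theorem prod_map_singleton' {X : Type*} (f : X → ℂ) (a : X) :
    (Multiset.map f {a}).prod = f a := by simp
/-- `Π` over a pair. -/
@[simp] theorem prod_map_pair' {X : Type*} (f : X → ℂ) (a b : X) :
    (Multiset.map f {a, b}).prod = f a * f b := by simp

end Summit.MatrixMultiplication.MatrixMultiplication.Theorems.GraphEquations

end
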